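import Mathlib
import HarnessLib
import Summits.Langlands.Langlands.Theses.ParityFreeBigHecke
import Literature.NumberTheory.GaloisRepresentations.AbsolutelyIrreducibleReduction

/-!
# Birth skeleton (BC3) for crux stmt-Langlands-18757
`Summit.Langlands.Langlands.Theses.ParityFreeBigHecke.PotentialProAutomorphy` — line `birth`

Route `route-Langlands-ParityFreeBigHecke` (`closes : PotentialProAutomorphy → Visibility →
DeRhamClassicality → TemperedPurity → AutomorphicPointCompatibility → TorsionGaloisRep →
SolvableDescent → GeometricRestrict → ReciprocityDataExist → TotallyImaginaryReduction → Langlands`).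
The crux (rank 2, NEW, deciding) says: for `E` totally complex, `n ≥ 1`, a reciprocity datum `R`, a
prime `ℓ` and an irreducible geometric `ρ : Γ_E → GL_n(ℚ̄_ℓ)` there are a finite Galois SOLVABLE
totally complex `F'/E` over which `ρ` stays irreducible, a tame level `𝒰` of `GL_n/F'` at `ℓ`, a
degree `i` and a `ℤ̄_ℓ`-valued family `a` of `T_{v,j}`-eigenvalues occurring in completed cohomology
(`TameLevel.EigensystemOccurs`, torsion classes at every depth) with `ρ|F'` associated to `a` off
`𝒰.bad` (`BigHeckeGLn.IsAssociatedFamily`).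

This file concludes the crux BY NAME from the first two of three named stubs, cut along the route
header's foreseen glued split "PotentialProAutomorphy ⇐ SolvableResidualOccurrence → BigRTLifting,
first rung BianchiSplitBigRTRung" (the stub names and statements are those already registered on the
item by the route's type-sketch planner, `ledger workitem stubs stmt-Langlands-18757`, re-typed here
verbatim so that the re-registration from `Cruxes/PotentialProAutomorphy/Lines/birth.lean` keeps the
stub set):

* `stub_solvableResidualOccurrence` — RESIDUAL PRO-AUTOMORPHY AFTER A SOLVABLE TOTALLY COMPLEX BASE
  CHANGE: for `ρ` irreducible geometric over a totally complex `E` there are a finite Galois solvable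
  totally complex `F'/E` with `ρ|F'` irreducible, a tame level `𝒰` over `F'` and SOME framed
  `ρ₁ : Γ_{F'} → GL_n(ℚ̄_ℓ)` which is pro-automorphic of tame level `𝒰` (its eigensystem occurs
  integrally in `H̃^i(𝒰)` and `ρ₁` is associated with it off `𝒰.bad`), residually congruent to
  `ρ|F'` (`FramedRep.IsResiduallyCongruent`: characteristic polynomials congruent modulo the maximal
  ideal of `ℤ̄_ℓ`, i.e. `ρ̄|F'ˢˢ ≅ ρ̄₁ˢˢ`), with `ρ|F'` unramified off `𝒰.bad`.  This is the
  Serre-type input of the line in the exact shape residual automorphy is classically manufactured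
  (Langlands–Tunnell; potential automorphy made solvable; Khare–Wintenberger induction) — the hardest
  stub: for insoluble `ρ̄` potential automorphy only gives INSOLUBLE `F'`, and reducible / small `ρ̄`,
  `n > 2`, has no engine.  Size: open-problem / XL.
* `stub_bigRTLifting` — BIG `R = 𝕋` (pro-automorphy propagates along residual congruences, NO
  condition at `ℓ`, no Hodge–Tate hypothesis): over a totally complex `F`, if `ρ₁` is pro-automorphic
  of tame level `𝒰` and `ρ₂` is irreducible, residually congruent to `ρ₁` and unramified off `𝒰.bad`,
  then `ρ₂` is pro-automorphic of some tame level `𝒰'`.  Calegari–Geraghty / Gee–Newton patching of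
  completed homology in defect `ℓ₀ = r₂(n−1) > 0` (arXiv:1207.4224 §5; arXiv:1609.06965 pp. 3–4,
  §5 "big `R = 𝕋`", conditional on the codimension / vanishing conjectures and finite-level
  local–global compatibility; unconditional pieces for `n = 2`, `F` imaginary quadratic).  As typed it
  also covers residually reducible (Eisenstein) `ρ₂`, where no patching engine exists (Skinner–Wiles /
  Pan shapes only over `ℚ`).  Size: open-problem / XL.
* `stub_bianchiSplitBigRTRung` — THE BC5 FIRST RUNG (plan-only; not consumed by the composition):
  `stub_bigRTLifting` for `n = 2`, `F` imaginary quadratic (`finrank ℚ F = 2`, totally complex), `ℓ`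
  odd and split in `F`, under the Taylor–Wiles hypothesis "`ρ̄₂|F(ζ_ℓ)` absolutely irreducible"
  (`FramedRep.HasAbsolutelyIrreducibleReduction (ρ₂.restrictField (CyclotomicField ℓ F))`) in place
  of irreducibility of `ρ₂` — the regime where the Calegari–Emerton conjectures are known
  (arXiv:1609.06965 p. 3) and `ℓ₀ = 1`.  Size: XL.

Shape (for `ledger skeleton check`): each stub is `theorem stub_<name> (binders) : <conclusion> := by
sorry`; `_Goal.stub_<name> : Prop := type_of% @stub_<name>` names that statement; the composition
`PotentialProAutomorphy_of (h₁ : _Goal.stub_solvableResidualOccurrence) (h₂ : _Goal.stub_bigRTLifting) :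
PotentialProAutomorphy` is proved without `sorry` (two stub calls: the solvable field, level and
congruent pro-automorphic `ρ₁` from `h₁`, then `h₂` at `ρ₂ := ρ|F'`) and concludes the route decl BY
NAME; the last `example` feeds the stubs to it.  No new definition is introduced: every stub is stated
over the route decl's own vocabulary (`BigHeckeGLn.TameLevel`, `TameLevel.EigensystemOccurs`,
`BigHeckeGLn.IsAssociatedFamily`, `FramedGaloisRep.restrictField`, `FramedGaloisRep.IsUnramifiedAt`,
`Summit.Langlands.IsGeometricFramed`, `Summit.Langlands.ReciprocityData`) plus the tree's residual
vocabulary `FramedRep.IsResiduallyCongruent` / `FramedRep.HasAbsolutelyIrreducibleReduction`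
(`Literature/NumberTheory/GaloisRepresentations/AbsolutelyIrreducibleReduction.lean`).

Disproof used: none — `ledger crux ls stmt-Langlands-18757` shows no `Disproof.lean` (no workfiles
before this line), the item carries no refuter / stub-false / line-dead notes, and
`ledger negatives --problem Langlands` has no entry about completed cohomology / pro-automorphy
(route header: 16951 MonomialSerreAtSplitPrimes is mod-`p` weight-one multiplicity, disjoint).
BC3 probes: see the registrar's NOTES.md (`bc/probes.lean`: the three stub statements restated
verbatim as `def Sᵢ : Prop` in a file WITHOUT the sorried stubs, battery
`first | exact? | simpa [Sᵢ] | (unfold Sᵢ; simpa) | aesop`, `maxHeartbeats 400000`, against the crux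
and against `Langlands`: all must fail).
-/

set_option linter.dupNamespace false

noncomputable section

namespace Summit.Langlands.Langlands.Cruxes.PotentialProAutomorphy.Birth

open Summit.Langlands.Langlands.Theses.ParityFreeBigHecke
open scoped BigOperators Topology Matrix NumberField
open Filter Set Function
open NumberField IsDedekindDomain Summit.Langlands
open Literature.NumberTheory.GaloisRepresentations Literature.NumberTheory.Automorphic

/-! ## 1. The three stubs -/

/-- **STUB 1 — RESIDUAL PRO-AUTOMORPHY AFTER A SOLVABLE TOTALLY COMPLEX BASE CHANGE.**  For `E`
totally complex, `n ≥ 1`, a reciprocity datum `R`, a prime `ℓ` and an irreducible `ρ : Γ_E → GL_n(ℚ̄_ℓ)`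
geometric for `R` (a.e. unramified, de Rham above `ℓ` for the pinned `D_pst`): there are a finite
Galois extension `F'/E`, totally complex with SOLVABLE Galois group, over which `ρ` stays irreducible,
a tame level `𝒰` of `GL_n/F'` at `ℓ` and a framed `ρ₁ : Γ_{F'} → GL_n(ℚ̄_ℓ)` such that (i) `ρ₁` is
pro-automorphic of tame level `𝒰` — some `ℤ̄_ℓ`-valued family `a` of `T_{v,j}`-eigenvalues occurs in
the completed cohomology `H̃^i(𝒰)` (`EigensystemOccurs`, torsion classes at every depth) and `ρ₁` is
associated with `a` off `𝒰.bad` (`IsAssociatedFamily`); (ii) `ρ|F'` is residually congruent to `ρ₁`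
(`FramedRep.IsResiduallyCongruent`: `‖cᵢ(ρ|F' σ) − cᵢ(ρ₁ σ)‖ < 1` for all `σ, i`, i.e. equal
semisimplified reductions); (iii) `ρ|F'` is unramified at every `v ∉ 𝒰.bad`.  Why plausibly true:
this is "Serre's conjecture after solvable base change" with the automorphic lift asked only
`ℓ`-ADICALLY (torsion occurrence in completed cohomology, any weight, any level at `ℓ`): for `n = 2`
and `ρ̄` with solvable projective image it is Langlands–Tunnell + base change; in general it is the
residual-automorphy input every automorphy-lifting theorem needs, weakened as far as the line allows.
Why it might fail: for insoluble `ρ̄` the only known source of residual automorphy (potential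
automorphy, BLGGT / ACC+ §6) produces INSOLUBLE `F'`; reducible / small-image `ρ̄` with `n > 2` has no
engine at all.  Hardest stub; size open-problem.  Leans on: `FramedGaloisRep.restrictField`,
`BigHeckeGLn.TameLevel.EigensystemOccurs`, `BigHeckeGLn.IsAssociatedFamily`,
`FramedRep.IsResiduallyCongruent`, `Summit.Langlands.IsGeometricFramed` (tree); Mathlib `IsSolvable`,
`IsGalois`, `NumberField.IsTotallyComplex`.
[cite: arXiv:1207.4224, §1 and §5] [cite: arXiv:1609.06965, pp. 3–4] [cite: ArthurClozel1989, III.4–6]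
[cite: AllenCalegariCaraianiGeeEtAl2023, §6] -/
theorem stub_solvableResidualOccurrence
    (E : Type) [Field E] [NumberField E] (hE : IsTotallyComplex E) (n : ℕ) (hn : 0 < n)
    (R : ReciprocityData E) (ℓ : ℕ) [Fact ℓ.Prime] (ρ : FramedGaloisRep E (PadicAlgCl ℓ) n)
    (hirr : ρ.toGaloisRep.IsIrreducible) (hgeo : IsGeometricFramed R ρ) :
    ∃ (F' : Type) (_ : Field F') (_ : NumberField F') (_ : Algebra E F') (_ : IsGalois E F'),
      IsTotallyComplex F' ∧ IsSolvable (F' ≃ₐ[E] F') ∧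
        (ρ.restrictField F').toGaloisRep.IsIrreducible ∧
        ∃ (𝒰 : BigHeckeGLn.TameLevel n F' ℓ) (ρ₁ : FramedGaloisRep F' (PadicAlgCl ℓ) n),
          (∃ (i : ℕ) (a : HeightOneSpectrum (𝓞 F') → ℕ →
              (Valued.v : Valuation (PadicAlgCl ℓ) NNReal).valuationSubring),
            𝒰.EigensystemOccurs (Valued.v : Valuation (PadicAlgCl ℓ) NNReal).valuationSubring a i ∧
              BigHeckeGLn.IsAssociatedFamily n 𝒰.bad
                (fun v j => ((a v j : (Valued.v : Valuation (PadicAlgCl ℓ) NNReal).valuationSubring) :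
                  PadicAlgCl ℓ)) ρ₁) ∧
          FramedRep.IsResiduallyCongruent (ρ.restrictField F') ρ₁ ∧
          ∀ v ∉ 𝒰.bad, (ρ.restrictField F').IsUnramifiedAt v := by
  sorry

/-- **STUB 2 — BIG `R = 𝕋`: PRO-AUTOMORPHY PROPAGATES ALONG RESIDUAL CONGRUENCES (no condition at
`ℓ`).**  For `F` totally complex, `n ≥ 1`, a prime `ℓ`, a tame level `𝒰` of `GL_n/F` at `ℓ` and framed
`ρ₁ ρ₂ : Γ_F → GL_n(ℚ̄_ℓ)`: if `ρ₁` is pro-automorphic of tame level `𝒰` (a `ℤ̄_ℓ`-family occurring in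
`H̃^i(𝒰)` with which `ρ₁` is associated off `𝒰.bad`), `ρ₂` is residually congruent to `ρ₁`,
irreducible, and unramified at every `v ∉ 𝒰.bad` (ramification above `ℓ` is free: every `v ∣ ℓ` is in
`𝒰.bad`), then `ρ₂` is pro-automorphic of SOME tame level `𝒰'` (deeper level at the places of
`𝒰.bad`).  Why plausibly true: this is the "big `R = 𝕋`" theorem shape — every deformation of a
pro-automorphic `ρ̄` unramified outside `S` is pro-automorphic — known for `GL_2/ℚ` (Böckle,
Emerton's local–global compatibility Thm. 1.2.3) and proved for `GL_n` over totally complex / CM `F`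
by Calegari–Geraghty–Gee–Newton patching of completed homology in defect `ℓ₀ = r₂(n−1)`
CONDITIONALLY on the codimension / vanishing conjectures and finite-level local–global compatibility
(arXiv:1609.06965 §5), with the non-Eisenstein Taylor–Wiles hypothesis.  Why it might fail: as typed
it has NO Taylor–Wiles / non-Eisenstein hypothesis (residually reducible irreducible `ρ₂`: only
Skinner–Wiles / Pan-type results over `ℚ`), and the codimension conjecture is open beyond `n = 2`,
`F` imaginary quadratic.  Size: open-problem / XL.  Leans on: `BigHeckeGLn.TameLevel`,
`TameLevel.EigensystemOccurs`, `BigHeckeGLn.IsAssociatedFamily`, `FramedRep.IsResiduallyCongruent`,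
`FramedGaloisRep.IsUnramifiedAt` (tree).
[cite: arXiv:1609.06965, pp. 3–4 and §5] [cite: arXiv:1207.4224, §5] [cite: CalegariGeraghty2017, Conj. A]
[cite: arXiv:2301.10509, Thm. 1.1] -/
theorem stub_bigRTLifting
    (F : Type) [Field F] [NumberField F] (hF : IsTotallyComplex F) (n : ℕ) (hn : 0 < n)
    (ℓ : ℕ) [Fact ℓ.Prime] (𝒰 : BigHeckeGLn.TameLevel n F ℓ)
    (ρ₁ ρ₂ : FramedGaloisRep F (PadicAlgCl ℓ) n)
    (hpro : ∃ (i : ℕ) (a : HeightOneSpectrum (𝓞 F) → ℕ →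
        (Valued.v : Valuation (PadicAlgCl ℓ) NNReal).valuationSubring),
      𝒰.EigensystemOccurs (Valued.v : Valuation (PadicAlgCl ℓ) NNReal).valuationSubring a i ∧
        BigHeckeGLn.IsAssociatedFamily n 𝒰.bad
          (fun v j => ((a v j : (Valued.v : Valuation (PadicAlgCl ℓ) NNReal).valuationSubring) :
            PadicAlgCl ℓ)) ρ₁)
    (hcong : FramedRep.IsResiduallyCongruent ρ₂ ρ₁) (hirr : ρ₂.toGaloisRep.IsIrreducible)
    (hur : ∀ v ∉ 𝒰.bad, ρ₂.IsUnramifiedAt v) :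
    ∃ (𝒰' : BigHeckeGLn.TameLevel n F ℓ) (i : ℕ)
      (a : HeightOneSpectrum (𝓞 F) → ℕ → (Valued.v : Valuation (PadicAlgCl ℓ) NNReal).valuationSubring),
      𝒰'.EigensystemOccurs (Valued.v : Valuation (PadicAlgCl ℓ) NNReal).valuationSubring a i ∧
        BigHeckeGLn.IsAssociatedFamily n 𝒰'.bad
          (fun v j => ((a v j : (Valued.v : Valuation (PadicAlgCl ℓ) NNReal).valuationSubring) :
            PadicAlgCl ℓ)) ρ₂ := by
  sorry

/-- **STUB 3 — THE BC5 FIRST RUNG `BianchiSplitBigRTRung` (plan-only; not consumed by the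
composition).**  `stub_bigRTLifting` in the regime where its inputs are theorems or nearly so: `n = 2`,
`F` imaginary quadratic (`F` totally complex with `finrank ℚ F = 2`), `ℓ ≠ 2` split in `F` (exactly two
primes of `𝓞 F` over `ℓ`), and the Taylor–Wiles hypothesis "`ρ̄₂|F(ζ_ℓ)` absolutely irreducible" in
Burnside form (`FramedRep.HasAbsolutelyIrreducibleReduction (ρ₂.restrictField (CyclotomicField ℓ F))`)
in place of the irreducibility of `ρ₂`: if `ρ₁` is pro-automorphic of tame level `𝒰` and `ρ₂ ≡ ρ₁`
residually with `ρ₂` unramified off `𝒰.bad`, then `ρ₂` is pro-automorphic of some tame level.  Here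
`ℓ₀ = 1`, the Calegari–Emerton codimension / vanishing conjectures are KNOWN (arXiv:1609.06965 p. 3:
"known if `n = 2` and `F` is imaginary quadratic"), torsion Galois representations exist (Scholze;
Caraiani–Newton local–global compatibility arXiv:2301.10509 in the split case), and "the only serious
obstruction is [the] finite level local–global compatibility conjecture" (arXiv:1609.06965 p. 4) — a
regime where the summit is NOT known (no Hodge–Tate / regularity hypothesis on `ρ₂`).  Technique:
CG `ℓ₀ = 1` patching (arXiv:1207.4224 §5) + Gee–Newton big `R = 𝕋` (arXiv:1609.06965 §5).  Size: XL.
[cite: arXiv:1609.06965, pp. 3–4, §5] [cite: arXiv:1207.4224, §5] [cite: arXiv:2301.10509, Thm. 1.1] -/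
theorem stub_bianchiSplitBigRTRung
    (F : Type) [Field F] [NumberField F] (hF : IsTotallyComplex F) (hdeg : Module.finrank ℚ F = 2)
    (ℓ : ℕ) [Fact ℓ.Prime] (hℓ : ℓ ≠ 2)
    (hsplit : ((Ideal.span {(ℓ : ℤ)}).primesOver (𝓞 F)).ncard = 2)
    (𝒰 : BigHeckeGLn.TameLevel 2 F ℓ) (ρ₁ ρ₂ : FramedGaloisRep F (PadicAlgCl ℓ) 2)
    (hpro : ∃ (i : ℕ) (a : HeightOneSpectrum (𝓞 F) → ℕ →
        (Valued.v : Valuation (PadicAlgCl ℓ) NNReal).valuationSubring),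
      𝒰.EigensystemOccurs (Valued.v : Valuation (PadicAlgCl ℓ) NNReal).valuationSubring a i ∧
        BigHeckeGLn.IsAssociatedFamily 2 𝒰.bad
          (fun v j => ((a v j : (Valued.v : Valuation (PadicAlgCl ℓ) NNReal).valuationSubring) :
            PadicAlgCl ℓ)) ρ₁)
    (hcong : FramedRep.IsResiduallyCongruent ρ₂ ρ₁)
    (hTW : FramedRep.HasAbsolutelyIrreducibleReduction (ρ₂.restrictField (CyclotomicField ℓ F)))
    (hur : ∀ v ∉ 𝒰.bad, ρ₂.IsUnramifiedAt v) :
    ∃ (𝒰' : BigHeckeGLn.TameLevel 2 F ℓ) (i : ℕ)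
      (a : HeightOneSpectrum (𝓞 F) → ℕ → (Valued.v : Valuation (PadicAlgCl ℓ) NNReal).valuationSubring),
      𝒰'.EigensystemOccurs (Valued.v : Valuation (PadicAlgCl ℓ) NNReal).valuationSubring a i ∧
        BigHeckeGLn.IsAssociatedFamily 2 𝒰'.bad
          (fun v j => ((a v j : (Valued.v : Valuation (PadicAlgCl ℓ) NNReal).valuationSubring) :
            PadicAlgCl ℓ)) ρ₂ := by
  sorry

/-! ## 2. The stub statements as named `Prop`s (literally the types of the stubs; no `sorry` inherited) -/

namespace _Goal

/-- The statement of `stub_solvableResidualOccurrence`, as a named `Prop` (literally its type). [folklore] -/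
def stub_solvableResidualOccurrence : Prop :=
  type_of% @Summit.Langlands.Langlands.Cruxes.PotentialProAutomorphy.Birth.stub_solvableResidualOccurrence

/-- The statement of `stub_bigRTLifting`, as a named `Prop` (literally its type). [folklore] -/
def stub_bigRTLifting : Prop :=
  type_of% @Summit.Langlands.Langlands.Cruxes.PotentialProAutomorphy.Birth.stub_bigRTLifting

/-- The statement of `stub_bianchiSplitBigRTRung`, as a named `Prop` (literally its type). [folklore] -/
def stub_bianchiSplitBigRTRung : Prop :=
  type_of% @Summit.Langlands.Langlands.Cruxes.PotentialProAutomorphy.Birth.stub_bianchiSplitBigRTRung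

end _Goal

/-! ## 3. The composition (kernel-checked, no `sorry`): SOLVABLE RESIDUAL OCCURRENCE → BIG R = 𝕋 → crux by name -/

/-- **The crux from the first two stubs.**  Given the crux data (`E` totally complex, `n ≥ 1`, `R`,
`ℓ`, an irreducible geometric `ρ`): STUB 1 produces the solvable totally complex Galois `F'/E` keeping
`ρ` irreducible, a tame level `𝒰` over `F'` and a pro-automorphic `ρ₁` residually congruent to `ρ|F'`
with `ρ|F'` unramified off `𝒰.bad`; STUB 2 over `F'` at `ρ₂ := ρ|F'` upgrades the congruence to
pro-automorphy of `ρ|F'` itself at some tame level `𝒰'`, which is the crux's conclusion.  Hypotheses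
are, by name, the statements of the two stubs; the conclusion is the route decl
`PotentialProAutomorphy`. [folklore] -/
theorem PotentialProAutomorphy_of (h₁ : _Goal.stub_solvableResidualOccurrence)
    (h₂ : _Goal.stub_bigRTLifting) : PotentialProAutomorphy := by
  intro E _ _ hE n hn R ℓ _ ρ hirr hgeo
  -- STUB 1: solvable totally complex `F'`, tame level `𝒰`, congruent pro-automorphic `ρ₁`
  obtain ⟨F', iF, iN, iA, iG, hF', hsolv, hirr', 𝒰, ρ₁, hpro, hcong, hur⟩ :=
    h₁ E hE n hn R ℓ ρ hirr hgeo
  -- STUB 2: big R = 𝕋 over `F'` at `ρ₂ := ρ|F'`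
  obtain ⟨𝒰', i, a, hocc, hassoc⟩ :=
    h₂ F' hF' n hn ℓ 𝒰 ρ₁ (ρ.restrictField F') hpro hcong hirr' hur
  exact ⟨F', iF, iN, iA, iG, hF', hsolv, hirr', 𝒰', i, a, hocc, hassoc⟩

/-- By-name sanity check (an `example`, so it is not a declaration of the file): the stubs feed the
composition as they stand. -/
example : PotentialProAutomorphy :=
  PotentialProAutomorphy_of stub_solvableResidualOccurrence stub_bigRTLifting

end Summit.Langlands.Langlands.Cruxes.PotentialProAutomorphy.Birth

end
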